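import Summits.CriticalPhenomena.PercolationContinuityZ3.Theorems.PercNearOneGluingNoHeavyLowerTailCILHyperedgeReduction
import HarnessLib

/-!
# `NoHeavyLowerTail` (stmt-CriticalPhenomena-4575) — the two-sided core with a two-port star: comparison on the stars, `j ≤ 2` OR few relays

Support file (prover `prim-hp-2`, deletion–contraction / pivotal-edge line; `--supports stmt-CriticalPhenomena-4575`).
No definitions, no named facts, no sorries.  Generalises `Hyperedge.levelTwo_compare` (`…CILTwoPortLevelTwoTools`, hypothesis `j ≤ 2`)
to the hypothesis `j ≤ 2 ∨ |A| ≤ j + 3`; companion of `…CILTwoPortFewRelays` (statement and story there) and of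
`…CILHyperedgeReduction` (`setCS_pair_of_hyperedgeDD`: the core with a two-port star `s₂` follows from the hyperedge inequality `DD ≥ 0`).

Setting and notation (`u`, `Y`, `Z`, `V_K`, `f_∅`, `f_{cd}`, events read "off `s`") exactly as in `…CILTwoPortLevelTwoTools`.

* `Hyperedge.compare_of_fewRelays` — for `i ∉ {c,d}` and (`j ≤ 2` or `|A| ≤ j + 3`):
  `CSdiff_u({s₁}, i) − Y·μ(Z)·μ(V_K) ≤ (1−Y)·f_∅ + Y·f_{cd} = DD`.
  On the star `σ_c` of `s₂` (mass `1 − Y`) both sides agree.  On `σ_{cd}` (mass `Y`) the witness event of `CSdiff_u` is the witness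
  event of `f_{cd}` plus the EXCEPTIONAL event `X = {i joined to the glued block {c,d}, i ↮ s₁, |π(i)| ≤ j}`; the observer event of
  `f_{cd}` and `X` are disjoint and both lie in (observer event of `CSdiff_u`) `∪ (Z ∩ V_K)`: on `X` the cluster of `s₁` avoids the
  three relays `i, c, d`, so it sees at most `|A| − 3 ≤ j` relays (and for `j ≤ 2` the event `X` is empty, three relays being joined
  to `i`).  Only here does the level enter; for `j ≥ 3`, `|A| ≥ j + 4` the discrepancy is a genuine event and `DD ≥ 0` is open.
  Exact pivotal decompositions only; no correlation inequality is used in this file.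
-/

noncomputable section

namespace Summit.CriticalPhenomena.PercolationContinuityZ3.Theorems

open MeasureTheory Set Literature.Probability.LatticeModels Literature.Probability.Percolation
open scoped Classical BigOperators

variable {n : ℕ}

namespace Hyperedge

open CutObserver KNPreFKG

/-- **Comparison on the stars of the glued two-port vertex (`j ≤ 2` or `|A| ≤ j + 3`).**  `u(s₂c) = 1`, the positive-weight
pairs at `s₂` end in the relays `c ≠ d`, every positive-weight neighbour of `s₁ ∉ A` is a listed relay, `i ∈ A ∖ {c,d}`, and
`j ≤ 2 ∨ |A| ≤ j + 3`.  With `Y = u(s₂d)`, `Z = {∀ l, s₁–p l closed}`, `V_K = {|π_K(c) ∪ π_K(d)| ≤ j}` (read off `s₁, s₂`) and the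
off-`s₂` terms `f_∅, f_{cd}` of `setCS_pair_of_hyperedgeDD`:  `CSdiff_u({s₁}, i) − Y·μ(Z)·μ(V_K) ≤ (1 − Y)·f_∅ + Y·f_{cd}`.
Mechanism: split over the stars `σ_c` (mass `1−Y`) and `σ_{cd}` (mass `Y`) of `s₂`; on `σ_c` the clusters are the off-`s₂` clusters;
on `σ_{cd}` the witness event of `CSdiff_u` exceeds that of `f_{cd}` by the exceptional event (`i` joined to the glued block), on which
the cluster of `s₁` avoids `i, c, d` and hence sees `≤ |A| − 3 ≤ j` relays (for `j ≤ 2` the exceptional event is empty); that event and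
the observer event of `f_{cd}` are disjoint and lie in the observer event of `CSdiff_u` or, when every pair at `s₁` is closed, in `Z ∩ V_K`.
[folklore] -/
theorem compare_of_fewRelays (u : Sym2 (Fin n) → unitInterval) (A : Finset (Fin n)) (s₁ s₂ c d i : Fin n) (j : ℕ)
    (hj : j ≤ 2 ∨ A.card ≤ j + 3)
    {m : ℕ} (p : Fin m → Fin n) (hpA : ∀ l, p l ∈ A) (hs₁A : s₁ ∉ A) (hs₂A : s₂ ∉ A) (h12 : s₁ ≠ s₂) (hcA : c ∈ A)
    (hdA : d ∈ A) (hcd : c ≠ d) (hiA : i ∈ A) (hic : i ≠ c) (hid : i ≠ d)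
    (hobs₁ : ∀ v, u s(s₁, v) ≠ 0 → ∃ l, v = p l) (hobs₂ : ∀ v, v ≠ s₂ → u s(s₂, v) ≠ 0 → v = c ∨ v = d)
    (huc : u s(s₂, c) = 1) :
    (prodBernoulli u).real {ω : BondConfig (Fin n) | ω ∉ openConn i s₁ ∧ (A.filter fun z => ω ∈ openConn i z).card ≤ j} -
        (prodBernoulli u).real {ω : BondConfig (Fin n) | ω ∉ openConn i s₁ ∧
          1 ≤ (A.filter fun z => ω ∈ openConn s₁ z).card ∧ (A.filter fun z => ω ∈ openConn s₁ z).card ≤ j} -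
      (u s(s₂, d) : ℝ) * ((prodBernoulli u).real {ω : BondConfig (Fin n) | ∀ l, s(s₁, p l) ∉ ω} *
        (prodBernoulli u).real {ω : BondConfig (Fin n) |
          (A.filter fun z => (openGraph ((ω ∩ {e | s₁ ∉ e}) ∩ {e | s₂ ∉ e})).Reachable c z ∨
            (openGraph ((ω ∩ {e | s₁ ∉ e}) ∩ {e | s₂ ∉ e})).Reachable d z).card ≤ j}) ≤
    (1 - (u s(s₂, d) : ℝ)) *
        ((prodBernoulli u).real {ω : BondConfig (Fin n) |
            (∀ y ∈ ({s₁} : Finset (Fin n)), ¬ (openGraph (ω ∩ {e | s₂ ∉ e})).Reachable i y) ∧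
              (A.filter fun z => (openGraph (ω ∩ {e | s₂ ∉ e})).Reachable i z).card ≤ j} -
          (prodBernoulli u).real {ω : BondConfig (Fin n) |
            (∀ y ∈ ({s₁} : Finset (Fin n)), ¬ (openGraph (ω ∩ {e | s₂ ∉ e})).Reachable i y) ∧
              1 ≤ (A.filter fun z => ∃ y ∈ ({s₁} : Finset (Fin n)), (openGraph (ω ∩ {e | s₂ ∉ e})).Reachable y z).card ∧
              (A.filter fun z => ∃ y ∈ ({s₁} : Finset (Fin n)), (openGraph (ω ∩ {e | s₂ ∉ e})).Reachable y z).card ≤ j}) +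
      (u s(s₂, d) : ℝ) *
        ((prodBernoulli u).real {ω : BondConfig (Fin n) |
            (∀ y ∈ ({s₁} ∪ {c, d} : Finset (Fin n)), ¬ (openGraph (ω ∩ {e | s₂ ∉ e})).Reachable i y) ∧
              (A.filter fun z => (openGraph (ω ∩ {e | s₂ ∉ e})).Reachable i z).card ≤ j} -
          (prodBernoulli u).real {ω : BondConfig (Fin n) |
            (∀ y ∈ ({s₁} ∪ {c, d} : Finset (Fin n)), ¬ (openGraph (ω ∩ {e | s₂ ∉ e})).Reachable i y) ∧
              1 ≤ (A.filter fun z => ∃ y ∈ ({s₁} ∪ {c, d} : Finset (Fin n)), (openGraph (ω ∩ {e | s₂ ∉ e})).Reachable y z).card ∧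
              (A.filter fun z => ∃ y ∈ ({s₁} ∪ {c, d} : Finset (Fin n)),
                (openGraph (ω ∩ {e | s₂ ∉ e})).Reachable y z).card ≤ j}) := by
  haveI : IsProbabilityMeasure (prodBernoulli u) := inferInstance
  set μ := prodBernoulli u with hμ
  have hcs : c ≠ s₂ := fun h => hs₂A (h ▸ hcA)
  have hds : d ≠ s₂ := fun h => hs₂A (h ▸ hdA)
  have hi2 : i ≠ s₂ := fun h => hs₂A (h ▸ hiA)
  have hi1 : i ≠ s₁ := fun h => hs₁A (h ▸ hiA)
  have hc1 : c ≠ s₁ := fun h => hs₁A (h ▸ hcA)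
  have hd1 : d ≠ s₁ := fun h => hs₁A (h ▸ hdA)
  have hp2 : ∀ l, p l ≠ s₂ := fun l h => hs₂A (h ▸ hpA l)
  have hp1 : ∀ l, p l ≠ s₁ := fun l h => hs₁A (h ▸ hpA l)
  set P : Finset (Fin n) := {c, d} with hP
  have hs₂P : s₂ ∉ P := by simp [hP, hcs.symm, hds.symm]
  have hPo : ∀ y ∈ P, y ≠ s₂ := fun y hy h => hs₂P (h ▸ hy)
  have hco : ∀ y ∈ ({c} : Finset (Fin n)), y ≠ s₂ := fun y hy => by
    rw [Finset.mem_singleton] at hy; exact hy ▸ hcs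
  have hobsP : ∀ y, y ≠ s₂ → y ∉ P → u s(s₂, y) = 0 := by
    intro y hy hyP
    by_contra h
    rcases hobs₂ y hy h with rfl | rfl <;> simp [hP] at hyP
  set Y : ℝ := (u s(s₂, d) : ℝ) with hY
  -- events
  set RS := {ω : BondConfig (Fin n) | ω ∉ openConn i s₁ ∧ (A.filter fun z => ω ∈ openConn i z).card ≤ j} with hRS
  set LS := {ω : BondConfig (Fin n) | ω ∉ openConn i s₁ ∧
    1 ≤ (A.filter fun z => ω ∈ openConn s₁ z).card ∧ (A.filter fun z => ω ∈ openConn s₁ z).card ≤ j} with hLS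
  set PR : Finset (Fin n) → BondConfig (Fin n) → Prop := fun S ξ =>
    (∀ y ∈ S, ¬ (openGraph ξ).Reachable i y) ∧ (A.filter fun z => (openGraph ξ).Reachable i z).card ≤ j with hPR
  set PL : Finset (Fin n) → BondConfig (Fin n) → Prop := fun S ξ =>
    (∀ y ∈ S, ¬ (openGraph ξ).Reachable i y) ∧
      1 ≤ (A.filter fun z => ∃ y ∈ S, (openGraph ξ).Reachable y z).card ∧
      (A.filter fun z => ∃ y ∈ S, (openGraph ξ).Reachable y z).card ≤ j with hPL
  set VK : BondConfig (Fin n) → Prop := fun ξ =>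
    (A.filter fun z => (openGraph ξ).Reachable c z ∨ (openGraph ξ).Reachable d z).card ≤ j with hVK
  set ZV : BondConfig (Fin n) → Prop := fun ξ => (∀ l, s(s₁, p l) ∉ ξ) ∧ VK (ξ ∩ {e | s₁ ∉ e}) with hZV
  set G := {ω : BondConfig (Fin n) | ∀ e ∈ ω, u e ≠ 0} with hG
  -- star probabilities of `s₂` under `u`
  obtain ⟨hν0, hνc, hνd, hνP⟩ := measureReal_starEvent_twoPort_cases u s₂ c d hcs hds hcd hobs₂
  rw [huc] at hν0 hνc hνd hνP
  simp only [Set.Icc.coe_one, sub_self, zero_mul, one_mul] at hν0 hνc hνd hνP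
  -- (a) splitting an event over the stars of `s₂`
  have hsplit : ∀ E : Set (BondConfig (Fin n)),
      μ.real E = μ.real (E ∩ starEvent s₂ (↑({c} : Finset (Fin n)) : Set (Fin n))) +
        μ.real (E ∩ starEvent s₂ (↑P : Set (Fin n))) := by
    intro E
    rw [real_eq_sum_inter_starEvent u P s₂ hs₂P hobsP E, hP, sum_powerset_pair c d hcd]
    have h0 : μ.real (E ∩ starEvent s₂ (↑(∅ : Finset (Fin n)) : Set (Fin n))) = 0 :=
      le_antisymm ((measureReal_mono inter_subset_right (measure_ne_top _ _)).trans hν0.le) measureReal_nonneg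
    have hd0 : μ.real (E ∩ starEvent s₂ (↑({d} : Finset (Fin n)) : Set (Fin n))) = 0 :=
      le_antisymm ((measureReal_mono inter_subset_right (measure_ne_top _ _)).trans hνd.le) measureReal_nonneg
    rw [h0, hd0, ← hP]; ring
  -- (b) the f-terms as masses on the stars
  have hfac : ∀ (B : Finset (Fin n)) (Q : BondConfig (Fin n) → Prop),
      μ.real (starEvent s₂ (↑B : Set (Fin n)) ∩ {ω | Q (ω ∩ {e | s₂ ∉ e})}) =
        μ.real (starEvent s₂ (↑B : Set (Fin n))) * μ.real {ω | Q (ω ∩ {e | s₂ ∉ e})} :=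
    fun B Q => measureReal_starEvent_inter_avoid u s₂ ↑B Q
  -- (c1),(c2): on `σ_c` the clusters are the off-`s₂` clusters
  have honC : ∀ ω ∈ starEvent s₂ (↑({c} : Finset (Fin n)) : Set (Fin n)), ∀ x z : Fin n, x ≠ s₂ → z ≠ s₂ →
      ((openGraph ω).Reachable x z ↔ (openGraph (ω ∩ {e | s₂ ∉ e})).Reachable x z) := by
    intro ω hω x z hx hz
    rw [reachable_iff_star hω hco hx hz]
    constructor
    · rintro (h | ⟨⟨b, hb, hbx⟩, ⟨b', hb', hb'z⟩⟩)
      · exact h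
      · rw [Finset.mem_singleton] at hb hb'
        subst hb; subst hb'
        exact hbx.symm.trans hb'z
    · exact fun h => Or.inl h
  have hRc : RS ∩ starEvent s₂ (↑({c} : Finset (Fin n)) : Set (Fin n)) =
      starEvent s₂ (↑({c} : Finset (Fin n)) : Set (Fin n)) ∩ {ω | PR {s₁} (ω ∩ {e | s₂ ∉ e})} := by
    ext ω
    simp only [hRS, hPR, mem_inter_iff, mem_setOf_eq]
    constructor
    · rintro ⟨⟨h1, h2⟩, hω⟩
      have heq : (A.filter fun z => ω ∈ openConn i z) =
          (A.filter fun z => (openGraph (ω ∩ {e | s₂ ∉ e})).Reachable i z) :=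
        Finset.filter_congr fun z hz => honC ω hω i z hi2 (fun h => hs₂A (h ▸ hz))
      refine ⟨hω, fun y hy => ?_, by rw [← heq]; exact h2⟩
      rw [Finset.mem_singleton] at hy; subst hy
      exact fun h => h1 ((honC ω hω i y hi2 h12).2 h)
    · rintro ⟨hω, h1, h2⟩
      have heq : (A.filter fun z => ω ∈ openConn i z) =
          (A.filter fun z => (openGraph (ω ∩ {e | s₂ ∉ e})).Reachable i z) :=
        Finset.filter_congr fun z hz => honC ω hω i z hi2 (fun h => hs₂A (h ▸ hz))
      refine ⟨⟨fun h => h1 s₁ (Finset.mem_singleton_self _) ((honC ω hω i s₁ hi2 h12).1 h), ?_⟩, hω⟩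
      rw [heq]; exact h2
  have hLc : LS ∩ starEvent s₂ (↑({c} : Finset (Fin n)) : Set (Fin n)) =
      starEvent s₂ (↑({c} : Finset (Fin n)) : Set (Fin n)) ∩ {ω | PL {s₁} (ω ∩ {e | s₂ ∉ e})} := by
    ext ω
    simp only [hLS, hPL, mem_inter_iff, mem_setOf_eq]
    have key : ω ∈ starEvent s₂ (↑({c} : Finset (Fin n)) : Set (Fin n)) → (A.filter fun z => ω ∈ openConn s₁ z) =
        (A.filter fun z => ∃ y ∈ ({s₁} : Finset (Fin n)), (openGraph (ω ∩ {e | s₂ ∉ e})).Reachable y z) := by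
      intro hω
      refine Finset.filter_congr fun z hz => ?_
      rw [show (ω ∈ openConn s₁ z) ↔ (openGraph (ω ∩ {e | s₂ ∉ e})).Reachable s₁ z from
        honC ω hω s₁ z h12 (fun h => hs₂A (h ▸ hz))]
      constructor
      · exact fun h => ⟨s₁, Finset.mem_singleton_self _, h⟩
      · rintro ⟨y, hy, hyz⟩; rw [Finset.mem_singleton] at hy; exact hy ▸ hyz
    constructor
    · rintro ⟨⟨h1, h2, h3⟩, hω⟩
      refine ⟨hω, fun y hy => ?_, by rw [← key hω]; exact h2, by rw [← key hω]; exact h3⟩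
      rw [Finset.mem_singleton] at hy; subst hy
      exact fun h => h1 ((honC ω hω i y hi2 h12).2 h)
    · rintro ⟨hω, h1, h2, h3⟩
      refine ⟨⟨fun h => h1 s₁ (Finset.mem_singleton_self _) ((honC ω hω i s₁ hi2 h12).1 h), ?_, ?_⟩, hω⟩
      · rw [key hω]; exact h2
      · rw [key hω]; exact h3
  -- (c3): on `σ_{cd}`, `RS` is the witness event of `f_{cd}` (read off `s₂`) plus the exceptional event `Xev` (`i` joined to the block)
  have hσ12 : ∀ ω ∈ starEvent s₂ (↑P : Set (Fin n)), ∀ b ∈ P, ∀ x : Fin n, x ≠ s₂ →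
      (openGraph (ω ∩ {e | s₂ ∉ e})).Reachable b x → (openGraph ω).Reachable c x ∧ (openGraph ω).Reachable d x := by
    intro ω hω b hb x hx hbx
    have hox : (openGraph ω).Reachable s₂ x := reachable_of_mem_star hω (hPo b hb) (Finset.mem_coe.2 hb) hbx
    have hoc : (openGraph ω).Reachable s₂ c :=
      reachable_of_mem_star hω hcs (by simp [hP]) (SimpleGraph.Reachable.refl _)
    have hod : (openGraph ω).Reachable s₂ d :=
      reachable_of_mem_star hω hds (by simp [hP]) (SimpleGraph.Reachable.refl _)
    exact ⟨hoc.symm.trans hox, hod.symm.trans hox⟩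
  set Xev : Set (BondConfig (Fin n)) :=
    starEvent s₂ (↑P : Set (Fin n)) ∩ (RS ∩ {ω | ∃ b ∈ P, (openGraph (ω ∩ {e | s₂ ∉ e})).Reachable b i}) with hXev
  have hRP : RS ∩ starEvent s₂ (↑P : Set (Fin n)) ⊆
      (starEvent s₂ (↑P : Set (Fin n)) ∩ {ω | PR ({s₁} ∪ P) (ω ∩ {e | s₂ ∉ e})}) ∪ Xev := by
    rintro ω ⟨hRSω, hω⟩
    by_cases hb : ∃ b ∈ P, (openGraph (ω ∩ {e | s₂ ∉ e})).Reachable b i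
    · exact Or.inr ⟨hω, hRSω, hb⟩
    · have h12' : ω ∉ openConn i s₁ ∧ (A.filter fun z => ω ∈ openConn i z).card ≤ j := by
        simpa only [hRS, mem_setOf_eq] using hRSω
      obtain ⟨h1, h2⟩ := h12'
      refine Or.inl ⟨hω, ?_⟩
      simp only [hPR, mem_setOf_eq]
      refine ⟨?_, ?_⟩
      · intro y hy
        rcases Finset.mem_union.1 hy with hy | hy
        · rw [Finset.mem_singleton] at hy; subst hy
          exact fun h => h1 (reachable_mono inter_subset_left h)
        · exact fun h => hb ⟨y, hy, h.symm⟩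
      · refine le_trans (Finset.card_le_card fun z hz => ?_) h2
        rw [Finset.mem_filter] at hz ⊢
        exact ⟨hz.1, reachable_mono inter_subset_left hz.2⟩
  have hRP' : μ.real (RS ∩ starEvent s₂ (↑P : Set (Fin n))) ≤
      μ.real (starEvent s₂ (↑P : Set (Fin n)) ∩ {ω | PR ({s₁} ∪ P) (ω ∩ {e | s₂ ∉ e})}) + μ.real Xev :=
    (measureReal_mono hRP (measure_ne_top _ _)).trans (measureReal_union_le _ _)
  -- on `Xev`: `i ↔ c` and `i ↔ d` in `ω`, so the relays joined to `s₁` avoid `i, c, d`; by `hj` there are at most `j` of them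
  have hXfacts : ∀ ω ∈ Xev, ω ∈ starEvent s₂ (↑P : Set (Fin n)) ∧ ω ∉ openConn i s₁ ∧
      (A.filter fun z => ω ∈ openConn i z).card ≤ j ∧ (openGraph ω).Reachable c i ∧ (openGraph ω).Reachable d i := by
    rintro ω ⟨hω, hRSω, ⟨b, hb, hbi⟩⟩
    have h12' : ω ∉ openConn i s₁ ∧ (A.filter fun z => ω ∈ openConn i z).card ≤ j := by
      simpa only [hRS, mem_setOf_eq] using hRSω
    exact ⟨hω, h12'.1, h12'.2, hσ12 ω hω b hb i hi2 hbi⟩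
  have hXN : ∀ ω ∈ Xev, (A.filter fun z => ω ∈ openConn s₁ z).card ≤ j := by
    intro ω hωX
    obtain ⟨-, h1, h2, hci, hdi⟩ := hXfacts ω hωX
    have h3 : ({i, c, d} : Finset (Fin n)) ⊆ A.filter fun z => ω ∈ openConn i z := by
      intro z hz
      simp only [Finset.mem_insert, Finset.mem_singleton] at hz
      rw [Finset.mem_filter]
      rcases hz with rfl | rfl | rfl
      · exact ⟨hiA, SimpleGraph.Reachable.refl _⟩
      · exact ⟨hcA, hci.symm⟩
      · exact ⟨hdA, hdi.symm⟩
    have hcard : ({i, c, d} : Finset (Fin n)).card = 3 := by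
      rw [Finset.card_insert_of_notMem (by simp [hic, hid]), Finset.card_pair hcd]
    rcases hj with hj | hj
    · have := Finset.card_le_card h3; omega
    · have hdj : Disjoint (A.filter fun z => ω ∈ openConn s₁ z) ({i, c, d} : Finset (Fin n)) := by
        rw [Finset.disjoint_right]
        intro z hz hz'
        rw [Finset.mem_filter] at hz'
        have hzi : (openGraph ω).Reachable i z := by
          simp only [Finset.mem_insert, Finset.mem_singleton] at hz
          rcases hz with rfl | rfl | rfl
          · exact SimpleGraph.Reachable.refl _
          · exact hci.symm
          · exact hdi.symm
        exact h1 (hzi.trans hz'.2.symm)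
      have hsub : (A.filter fun z => ω ∈ openConn s₁ z) ∪ ({i, c, d} : Finset (Fin n)) ⊆ A := by
        intro z hz
        rcases Finset.mem_union.1 hz with hz | hz
        · exact (Finset.mem_filter.1 hz).1
        · simp only [Finset.mem_insert, Finset.mem_singleton] at hz
          rcases hz with rfl | rfl | rfl
          exacts [hiA, hcA, hdA]
      have := Finset.card_le_card hsub
      rw [Finset.card_union_of_disjoint hdj, hcard] at this
      omega
  -- (c4): on `σ_{cd}` the observer event of `f_{cd}` and `Xev` are disjoint and both inside `LS ∪ {Z ∧ V_K}` (up to the null event `Gᶜ`)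
  have hdisjX : Disjoint (starEvent s₂ (↑P : Set (Fin n)) ∩ {ω | PL ({s₁} ∪ P) (ω ∩ {e | s₂ ∉ e})}) Xev := by
    rw [Set.disjoint_left]
    rintro ω ⟨-, hPLω⟩ ⟨-, -, ⟨b, hb, hbi⟩⟩
    have hPL' : (∀ y ∈ ({s₁} ∪ P : Finset (Fin n)), ¬ (openGraph (ω ∩ {e | s₂ ∉ e})).Reachable i y) ∧
        1 ≤ (A.filter fun z => ∃ y ∈ ({s₁} ∪ P : Finset (Fin n)), (openGraph (ω ∩ {e | s₂ ∉ e})).Reachable y z).card ∧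
        (A.filter fun z => ∃ y ∈ ({s₁} ∪ P : Finset (Fin n)), (openGraph (ω ∩ {e | s₂ ∉ e})).Reachable y z).card ≤ j := by
      simpa only [hPL, mem_setOf_eq] using hPLω
    exact hPL'.1 b (Finset.mem_union_right _ hb) hbi.symm
  have hLP : ((starEvent s₂ (↑P : Set (Fin n)) ∩ {ω | PL ({s₁} ∪ P) (ω ∩ {e | s₂ ∉ e})}) ∪ Xev) ∩ G ⊆
      (LS ∩ starEvent s₂ (↑P : Set (Fin n))) ∪ (starEvent s₂ (↑P : Set (Fin n)) ∩ {ω | ZV (ω ∩ {e | s₂ ∉ e})}) := by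
    rintro ω ⟨hω', hωG⟩
    -- the three facts used below, established in both cases
    have hfacts : ω ∈ starEvent s₂ (↑P : Set (Fin n)) ∧ ω ∉ openConn i s₁ ∧
        (A.filter fun z => ω ∈ openConn s₁ z).card ≤ j ∧
        (A.filter fun z => (openGraph (ω ∩ {e | s₂ ∉ e})).Reachable c z ∨
          (openGraph (ω ∩ {e | s₂ ∉ e})).Reachable d z).card ≤ j := by
      rcases hω' with ⟨hω, hPLω⟩ | hωX
      · have hPL' : (∀ y ∈ ({s₁} ∪ P : Finset (Fin n)), ¬ (openGraph (ω ∩ {e | s₂ ∉ e})).Reachable i y) ∧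
            1 ≤ (A.filter fun z => ∃ y ∈ ({s₁} ∪ P : Finset (Fin n)), (openGraph (ω ∩ {e | s₂ ∉ e})).Reachable y z).card ∧
            (A.filter fun z => ∃ y ∈ ({s₁} ∪ P : Finset (Fin n)), (openGraph (ω ∩ {e | s₂ ∉ e})).Reachable y z).card ≤ j := by
          simpa only [hPL, mem_setOf_eq] using hPLω
        obtain ⟨h1, -, h3⟩ := hPL'
        have hi1' : ¬ (openGraph (ω ∩ {e | s₂ ∉ e})).Reachable i s₁ := h1 s₁ (by simp)
        have hnot : ¬ ∃ b ∈ P, (openGraph (ω ∩ {e | s₂ ∉ e})).Reachable b i :=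
          fun ⟨b, hb, hbi⟩ => h1 b (Finset.mem_union_right _ hb) hbi.symm
        have hisep : ω ∉ openConn i s₁ := by
          intro h
          rcases (reachable_iff_star hω hPo hi2 h12).1 h with h' | ⟨hb, -⟩
          · exact hi1' h'
          · exact hnot hb
        refine ⟨hω, hisep, ?_, ?_⟩
        · refine le_trans (Finset.card_le_card fun z hz => ?_) h3
          rw [Finset.mem_filter] at hz ⊢
          refine ⟨hz.1, ?_⟩
          rcases (reachable_iff_star hω hPo h12 (fun h' => hs₂A (h' ▸ hz.1))).1 hz.2 with h' | ⟨-, ⟨b', hb', hb'z⟩⟩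
          · exact ⟨s₁, Finset.mem_union_left _ (Finset.mem_singleton_self _), h'⟩
          · exact ⟨b', Finset.mem_union_right _ hb', hb'z⟩
        · refine le_trans (Finset.card_le_card fun z hz => ?_) h3
          rw [Finset.mem_filter] at hz ⊢
          refine ⟨hz.1, ?_⟩
          rcases hz.2 with h | h
          · exact ⟨c, Finset.mem_union_right _ (by simp [hP]), h⟩
          · exact ⟨d, Finset.mem_union_right _ (by simp [hP]), h⟩
      · obtain ⟨hω, h1, h2, hci, hdi⟩ := hXfacts ω hωX
        refine ⟨hω, h1, hXN ω hωX, ?_⟩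
        refine le_trans (Finset.card_le_card fun z hz => ?_) h2
        rw [Finset.mem_filter] at hz ⊢
        refine ⟨hz.1, ?_⟩
        rcases hz.2 with h | h
        · exact hci.symm.trans (reachable_mono inter_subset_left h)
        · exact hdi.symm.trans (reachable_mono inter_subset_left h)
    obtain ⟨hω, hisep, hN, hV⟩ := hfacts
    by_cases hO : ∃ l, s(s₁, p l) ∈ ω
    · left -- some pair at s₁ open: ω ∈ LS
      obtain ⟨l, hl⟩ := hO
      refine ⟨?_, hω⟩
      simp only [hLS, mem_setOf_eq]
      refine ⟨hisep, ?_, hN⟩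
      refine Finset.card_pos.2 ⟨p l, Finset.mem_filter.2 ⟨hpA l, ?_⟩⟩
      have hadj : (openGraph ω).Adj s₁ (p l) := by
        rw [openGraph, SimpleGraph.fromEdgeSet_adj]; exact ⟨hl, (hp1 l).symm⟩
      exact hadj.reachable
    · right -- every pair at s₁ closed: s₁ is isolated (weight-0 pairs are closed on G)
      simp only [not_exists] at hO
      have hiso : ∀ v, s(s₁, v) ∉ ω := by
        intro v hv
        by_cases hv1 : v = s₁
        · subst hv1
          obtain ⟨l, hl⟩ := hobs₁ v (hωG _ hv)
          exact hp1 l hl.symm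
        · obtain ⟨l, rfl⟩ := hobs₁ v (hωG _ hv)
          exact hO l hv
      have hξ : (ω ∩ {e | s₂ ∉ e}) ∩ {e | s₁ ∉ e} = ω ∩ {e | s₂ ∉ e} := by
        ext e
        simp only [mem_inter_iff, mem_setOf_eq, and_iff_left_iff_imp, and_imp]
        intro he _ h1e
        have : e = s(s₁, Sym2.Mem.other h1e) := (Sym2.other_spec h1e).symm
        exact hiso _ (this ▸ he)
      refine ⟨hω, fun l => fun h => hiso (p l) h.1, ?_⟩
      show VK ((ω ∩ {e | s₂ ∉ e}) ∩ {e | s₁ ∉ e})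
      rw [hξ]
      exact hV
  have hLP' : μ.real (starEvent s₂ (↑P : Set (Fin n)) ∩ {ω | PL ({s₁} ∪ P) (ω ∩ {e | s₂ ∉ e})}) + μ.real Xev ≤
      μ.real (LS ∩ starEvent s₂ (↑P : Set (Fin n))) + μ.real (starEvent s₂ (↑P : Set (Fin n)) ∩ {ω | ZV (ω ∩ {e | s₂ ∉ e})}) := by
    rw [← measureReal_union hdisjX MeasurableSet.of_discrete,
      ← measureReal_inter_support u ((starEvent s₂ (↑P : Set (Fin n)) ∩ {ω | PL ({s₁} ∪ P) (ω ∩ {e | s₂ ∉ e})}) ∪ Xev)]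
    exact (measureReal_mono hLP (measure_ne_top _ _)).trans (measureReal_union_le _ _)
  -- (d) the correction term: `μ(σ_P ∩ {ZV}) = Y · μ(Z) · μ(V_K)`
  set Ports : Finset (Sym2 (Fin n)) := Finset.univ.image fun l : Fin m => s(s₁, p l) with hPorts
  set E1 : Finset (Sym2 (Fin n)) := Finset.univ.filter fun e : Sym2 (Fin n) => s₁ ∉ e with hE1
  have hdisj : Disjoint Ports E1 := by
    rw [Finset.disjoint_left]; intro e he he'
    rw [hPorts, Finset.mem_image] at he; obtain ⟨l, -, rfl⟩ := he
    rw [hE1, Finset.mem_filter] at he'; exact he'.2 (Sym2.mem_mk_left _ _)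
  have hZ_det : DeterminedBy {ω : BondConfig (Fin n) | ∀ l, s(s₁, p l) ∉ ω} (↑Ports : Set (Sym2 (Fin n))) := by
    rw [determinedBy_iff]; intro ω ω' h
    simp only [mem_setOf_eq]
    refine forall_congr' fun l => ?_
    have hmem : s(s₁, p l) ∈ (↑Ports : Set (Sym2 (Fin n))) := by rw [Finset.mem_coe, hPorts, Finset.mem_image]; exact ⟨l, by simp, rfl⟩
    have := Set.ext_iff.1 h (s(s₁, p l))
    simp only [mem_inter_iff, hmem, and_true] at this
    rw [this]
  have hV_det : DeterminedBy {ω : BondConfig (Fin n) | VK ((ω ∩ {e | s₁ ∉ e}) ∩ {e | s₂ ∉ e})} (↑E1 : Set (Sym2 (Fin n))) := by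
    have h := determinedBy_restrict E1 (fun ξ => VK (ξ ∩ {e | s₂ ∉ e}))
    rw [hE1, coe_edgesAvoiding] at h ⊢; exact h
  have hZV : μ.real {ω | ZV (ω ∩ {e | s₂ ∉ e})} = μ.real {ω : BondConfig (Fin n) | ∀ l, s(s₁, p l) ∉ ω} *
      μ.real {ω : BondConfig (Fin n) | VK ((ω ∩ {e | s₁ ∉ e}) ∩ {e | s₂ ∉ e})} := by
    have hev : {ω : BondConfig (Fin n) | ZV (ω ∩ {e | s₂ ∉ e})} =
        {ω : BondConfig (Fin n) | ∀ l, s(s₁, p l) ∉ ω} ∩ {ω | VK ((ω ∩ {e | s₁ ∉ e}) ∩ {e | s₂ ∉ e})} := by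
      ext ω
      have hmem : ∀ l, (s(s₁, p l) ∈ ω ∩ {e : Sym2 (Fin n) | s₂ ∉ e} ↔ s(s₁, p l) ∈ ω) := fun l =>
        ⟨fun h => h.1, fun h => ⟨h, fun h2 => (hp2 l) ((Sym2.mem_iff.1 h2).resolve_left h12.symm).symm⟩⟩
      show ((∀ l, s(s₁, p l) ∉ ω ∩ {e | s₂ ∉ e}) ∧ VK ((ω ∩ {e | s₂ ∉ e}) ∩ {e | s₁ ∉ e})) ↔
        ω ∈ {ω : BondConfig (Fin n) | ∀ l, s(s₁, p l) ∉ ω} ∩ {ω | VK ((ω ∩ {e | s₁ ∉ e}) ∩ {e | s₂ ∉ e})}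
      rw [mem_inter_iff, mem_setOf_eq, mem_setOf_eq, Set.inter_right_comm]
      simp only [hmem]
    rw [hev]
    exact prodBernoulli_real_inter_of_determinedBy_disjoint u hdisj hZ_det hV_det MeasurableSet.of_discrete MeasurableSet.of_discrete
  -- (e) assemble
  have hR := hsplit RS
  have hL := hsplit LS
  rw [hRc] at hR
  rw [hLc] at hL
  have e1 := hfac {c} (PR {s₁})
  have e2 := hfac {c} (PL {s₁})
  have e3 := hfac P (PR ({s₁} ∪ P))
  have e4 := hfac P (PL ({s₁} ∪ P))
  have e5 := hfac P ZV
  rw [hνc] at e1 e2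
  rw [hνP] at e3 e4 e5
  rw [hZV] at e5
  linarith [hR, hL, e1, e2, e3, e4, e5, hLP', hRP']

end Hyperedge

end Summit.CriticalPhenomena.PercolationContinuityZ3.Theorems

end
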